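import Literature.NumberTheory.GaloisRepresentations.GalLayerSystemColimit
import Literature.NumberTheory.GaloisRepresentations.GalLayerSystemSES
import Literature.NumberTheory.GaloisRepresentations.IdeleLocalInvariantsInflationArch
import Literature.NumberTheory.GaloisRepresentations.IdeleLocalInvariantsRange
import Literature.Algebra.Homology.DiscreteRepLayerColimitDesc
import HarnessLib

/-!
# Descent of compatible layer maps to `Extⁿ_{C_Γ}(ℤ, lim→ S)`, and the local invariants `inv_v : H²(Γ_F, J̄) → ℚ/ℤ` of the
# limit idèle module (Tate, C–F VII §7.3 Cor. 7.4, §9.7 (14), §11.2; Harari §13.1 Prop. 13.1)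

Topic `NumberTheory/GaloisRepresentations`; namespace `Literature.NumberTheory.GaloisRepresentations` (generic part in
`GalLayerData`).  Sequel to `GalLayerSystemColimit.lean` (door-c5 g16: `D.inflLayer E n : Hⁿ(Gal(E/F), D.obj E) →+ Extⁿ_{C_Γ}(ℤ, lim D)`,
`inflLayer_inf`, `exists_inflLayer_eq`, `exists_inf_eq_inf`), door-c4's descent over a cofinal family of open normal subgroups
(`DiscreteRepLayerColimitDesc.lean`, g16: `IsCompatibleFamily`, `desc`, `desc_inflG`, `desc_injective`) and the cell's finite-layer
local invariants
(`IdeleLocalInvariants*.lean`: `localInv E v`, `localInvInf E v`; their inflation invariance `localInv_ideleInf`,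
`localInvInf_ideleInf` — door-c5 g14/g15; `eq_zero_of_forall_localInv_eq_zero'`).  Definitions with bodies and
theorems; NO named fact, no `sorry`, no instance, no notation.  Route A of crux `AnticycControlAdditiveK` (item 19295): the local
invariants on `H²(Γ_F, J̄)` are the `J̄`-side of the compatibility (A6) / Milne I Lemma 4.13 at `r = 2`.

Mathematics.  (1) DESCENT: a family of additive maps `f_E : Hⁿ(Gal(E/F), S_E) → A` compatible with the inflations of a Galois
layer system (`f_{E'} ∘ Inf = f_E`) descends uniquely to `f : Extⁿ_{C_Γ}(ℤ, lim→ S) → A` with `f ∘ Inf_E = f_E` — because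
`Extⁿ(ℤ, lim S) = lim→_U Hⁿ(Γ⧸U, (lim S)^U)` may be computed over the cofinal family `U_E = Gal(F̄/E)` of open normal subgroups
(Serre I §2.2 Prop. 8), whose layers are the `Hⁿ(Gal(E/F), S_E)` (`GalLayerData.layerCohomologyIso`, under which door-c4's
transitions `stepG` are the system's inflations).  (2) For `S = J`, the local invariants `inv_v : H²(Gal(E/F), J_E) → ℚ/ℤ` (`v` a finite or
infinite place of `F`) are inflation-invariant (Tate VII §9.7 (14)), hence give `inv_v : H²(Γ_F, J̄) → ℚ/ℤ`; almost all `inv_v(x)` vanish and **`x ↦ (inv_v(x))_v` is injective** (Tate VII §7.3 Cor. 7.4 (b):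
`H²(G, J_L) ≅ ⊕_v H²(G_v, L_wˣ)` and the injectivity of the local invariants, at every layer).

## What is formalised (`F : Type` a number field, `Γ = absoluteGaloisGroup F`)

* §1 generic (`D : GalLayerData F`): `layerFamily` (the family on door-c4's layers), `layerCohomologyIso_hom_stepG`,
  `eq_of_inflLayer_eq`, **`isCompatibleFamily_layerFamily`** (door-c4's `IsCompatibleFamily` over the cofinal family `E ↦ U_E`),
  **`D.liftLayer f hf : Extⁿ_{C_Γ}(ℤ, lim D) →+ A`** (`:= DiscreteRep.LayerColimit.desc …`), **`liftLayer_inflLayer`**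
  (`lift (Inf_E c) = f_E c`), `liftLayer_unique`, `liftLayer_injective`, `liftLayer_surjective`.
* §2 `J̄`: the layer families `famLocalInv`, `famLocalInvInf` (the cell's `inv_v` re-typed on `(ideleData F).obj E`; `_eq` bridges
  by `rfl`, any instances) and their compatibility with the system `famLocalInv_inf`, `famLocalInvInf_inf`;
  **`ideleBarLocalInv F v`**, **`ideleBarLocalInvInf F v`** (`: Ext²_{C_Γ}(ℤ, J̄) →+ ℚ/ℤ`) with `_inflLayer` / `_inflLayer'` formulas;
  `exists_finset_forall_ideleBarLocalInv_eq_zero` (almost all vanish); **`ideleBar_eq_zero_of_forall_localInv_eq_zero`**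
  (`H²(Γ_F, J̄) ↪ ⊕_v ℚ/ℤ`), `ideleBar_eq_of_forall_localInv_eq`.  (The total invariant `inv = Σ_v inv_v` on `J̄` is then the finite
  sum of these; not defined here.)

## References
* J. W. S. Cassels, A. Fröhlich (eds.), *Algebraic Number Theory* (1967), Ch. VII (J. Tate) §7.3 Cor. 7.4, §9.7 (14), §11.2.
  [CasselsFrohlichANT1967]
* D. Harari, *Galois Cohomology and Class Field Theory* (2020), §13.1 Prop. 13.1. [Harari2020]
-/

noncomputable section

open CategoryTheory CategoryTheory.Abelian NumberField groupCohomology IsDedekindDomain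
open Field (absoluteGaloisGroup)
open Literature.Algebra.Homology
open scoped Classical

namespace Literature.NumberTheory.GaloisRepresentations

open IdeleClassBar

/-! ## §1. Descent of compatible layer maps -/

namespace GalLayerData

variable {F : Type} [Field F] [NumberField F] (D : GalLayerData F) {n : ℕ} {A : Type} [AddCommGroup A]
  (f : ∀ E : GalLayer F, groupCohomology (D.obj E) n →+ A)

/-- The family transported to door-c4's layers `Hⁿ(Γ_F ⧸ U_E, (lim D)^{U_E})` along the layer cohomology isomorphisms
`layerCohomologyIso E n`. [cite: SerreGaloisCohomology1997, I §2.2 Proposition 8] -/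
def layerFamily (E : GalLayer F) : groupCohomology (D.layerRep E) n →+ A :=
  (f E).comp (D.layerCohomologyIso E n).toLinearEquiv.toAddMonoidHom

/-- Formula. [cite: SerreGaloisCohomology1997, I §2.2 Proposition 8] -/
theorem layerFamily_apply (E : GalLayer F) (c' : groupCohomology (D.layerRep E) n) :
    D.layerFamily f E c' = f E ((D.layerCohomologyIso E n).hom c') := rfl

/-- **`iso_{E'} ∘ stepG = D.inf ∘ iso_E`** on elements (door-c4's transition `stepG U_E U_{E'}` is the system's inflation under
the layer cohomology isomorphisms; `map_invariantsStepIncl_comp_layerCohomologyIso`). [cite: SerreGaloisCohomology1997, I §2.2 Proposition 8] -/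
theorem layerCohomologyIso_hom_stepG {E E' : GalLayer F} (hEE' : E ≤ E')
    (h : (E'.openNormalSubgroup : Subgroup (absoluteGaloisGroup F)) ≤ E.openNormalSubgroup)
    (c' : groupCohomology (D.layerRep E) n) :
    (D.layerCohomologyIso E' n).hom
        (DiscreteRep.LayerColimit.stepG E.openNormalSubgroup E'.openNormalSubgroup h D.toSystem.toD n c') =
      D.inf hEE' n ((D.layerCohomologyIso E n).hom c') := by
  have e := D.layerCohomologyIso_inv_inf hEE' n ((D.layerCohomologyIso E n).hom c')
  rw [Iso.hom_inv_id_apply] at e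
  have e' := congrArg (D.layerCohomologyIso E' n).hom e
  rw [Iso.inv_hom_id_apply] at e'
  exact e'.symm

variable (hf : ∀ {E E' : GalLayer F} (h : E ≤ E') (c : groupCohomology (D.obj E) n), f E' (D.inf h n c) = f E c)

include hf in
/-- **A compatible family is constant on the fibres of the inflations**: if `Inf_E c = Inf_{E'} c'` in `Extⁿ(ℤ, lim D)` then
`f_E c = f_{E'} c'` (compare in a common layer, then kill the difference by a further inflation, `exists_inf_eq_inf`).
[cite: CasselsFrohlichANT1967, Ch. VII §9.7] -/
theorem eq_of_inflLayer_eq {E E' : GalLayer F} (c : groupCohomology (D.obj E) n) (c' : groupCohomology (D.obj E') n)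
    (h : D.inflLayer E n c = D.inflLayer E' n c') : f E c = f E' c' := by
  obtain ⟨M, hE, hE'⟩ := GalLayer.exists_ge_ge E E'
  have hM : D.inflLayer M n (D.inf hE n c) = D.inflLayer M n (D.inf hE' n c') := by
    rw [D.inflLayer_inf hE, D.inflLayer_inf hE', h]
  obtain ⟨M', hM', hMM'⟩ := D.exists_inf_eq_inf n M _ _ hM
  rw [← hf hE c, ← hf hM' (D.inf hE n c), hMM', hf hM', hf hE']

include hf in
/-- **A family compatible with the system's inflations is a compatible family on the cofinal set of layers `U_E`** in
door-c4's sense (`DiscreteRep.LayerColimit.IsCompatibleFamily`: every open normal subgroup of `Γ_F` is a `U_E`, and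
`f_{E'} ∘ iso_{E'} ∘ stepG = f_E ∘ iso_E`). [cite: SerreGaloisCohomology1997, I §2.2 Proposition 8] -/
theorem isCompatibleFamily_layerFamily :
    DiscreteRep.LayerColimit.IsCompatibleFamily (fun E : GalLayer F => E.openNormalSubgroup) D.toSystem.toD n
      (D.layerFamily f) where
  cofinal W := ⟨GalLayer.ofOpenNormalSubgroup W, (GalLayer.openNormalSubgroup_ofOpenNormalSubgroup W).le⟩
  compat E E' h c' := by
    have hEE' : E ≤ E' := GalLayer.openNormalSubgroup_le_iff.1 h
    change f E' ((D.layerCohomologyIso E' n).hom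
        (DiscreteRep.LayerColimit.stepG E.openNormalSubgroup E'.openNormalSubgroup h D.toSystem.toD n c')) =
      f E ((D.layerCohomologyIso E n).hom c')
    rw [D.layerCohomologyIso_hom_stepG hEE' h c', hf hEE']

/-- **DESCENT: the additive map `Extⁿ_{C_Γ}(ℤ, lim→ D) →+ A` induced by a family of layer maps compatible with the system's
inflations** — door-c4's `DiscreteRep.LayerColimit.desc` over the cofinal family `E ↦ U_E`, the family transported along the
layer cohomology isomorphisms (value at `x` = `f_E c` for any `E, c` with `Inf_E c = x`).
[cite: SerreGaloisCohomology1997, I §2.2 Proposition 8][cite: CasselsFrohlichANT1967, Ch. VII §9.7] -/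
def liftLayer : Ext (DiscreteRep.triv (Γ := absoluteGaloisGroup F) ℤ) D.toSystem.toD n →+ A :=
  DiscreteRep.LayerColimit.desc (fun E : GalLayer F => E.openNormalSubgroup) D.toSystem.toD n (D.layerFamily f)
    (D.isCompatibleFamily_layerFamily f hf)

/-- **`lift (Inf_E c) = f_E c`** (door-c4's `desc_inflG`, `inflLayer = inflG ∘ iso⁻¹`). [cite: SerreGaloisCohomology1997, I §2.2 Proposition 8] -/
theorem liftLayer_inflLayer (E : GalLayer F) (c : groupCohomology (D.obj E) n) :
    D.liftLayer f hf (D.inflLayer E n c) = f E c := by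
  have h := DiscreteRep.LayerColimit.desc_inflG (D.isCompatibleFamily_layerFamily f hf) E
    ((D.layerCohomologyIso E n).inv c)
  rw [layerFamily_apply, Iso.inv_hom_id_apply] at h
  rw [inflLayer_apply]
  exact h

/-- **Uniqueness of the descent**: an additive map agreeing with `f_E` on every `Inf_E` is `liftLayer f`.
[cite: SerreGaloisCohomology1997, I §2.2 Proposition 8] -/
theorem liftLayer_unique (g : Ext (DiscreteRep.triv (Γ := absoluteGaloisGroup F) ℤ) D.toSystem.toD n →+ A)
    (hg : ∀ (E : GalLayer F) (c : groupCohomology (D.obj E) n), g (D.inflLayer E n c) = f E c) : g = D.liftLayer f hf := by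
  refine AddMonoidHom.ext fun x => ?_
  obtain ⟨E, c, rfl⟩ := D.exists_inflLayer_eq n x
  rw [hg E c, D.liftLayer_inflLayer f hf E c]

/-- **`liftLayer f` is injective when every `f_E` is.** [cite: SerreGaloisCohomology1997, I §2.2 Proposition 8] -/
theorem liftLayer_injective (hinj : ∀ E : GalLayer F, Function.Injective (f E)) :
    Function.Injective (D.liftLayer f hf) :=
  DiscreteRep.LayerColimit.desc_injective (D.isCompatibleFamily_layerFamily f hf) fun E =>
    (hinj E).comp (D.layerCohomologyIso E n).toLinearEquiv.injective

/-- **`liftLayer f` is surjective when the `f_E` are jointly surjective.** [cite: SerreGaloisCohomology1997, I §2.2 Proposition 8] -/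
theorem liftLayer_surjective (hsurj : ∀ a : A, ∃ (E : GalLayer F) (c : groupCohomology (D.obj E) n), f E c = a) :
    Function.Surjective (D.liftLayer f hf) := fun a => by
  obtain ⟨E, c, rfl⟩ := hsurj a
  exact ⟨D.inflLayer E n c, D.liftLayer_inflLayer f hf E c⟩

end GalLayerData

/-! ## §2. The local invariants of `H²(Γ_F, J̄)`

Implementation note.  The cell's maps `localInv E v`, `localInvInf E v` live on `H²(Gal(E/F), ideleRep F E)`,
which is `H²(Gal(E/F), (ideleData F).obj E)` definitionally (`ideleData_obj`); we re-type them on the layers of the system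
(`famLocalInv`, `famLocalInvInf`, with `rfl`-bridges `famLocalInv_eq`, `famLocalInvInf_eq` valid for any instances on the layer)
and prove their compatibility with the system's inflations from the cell's inflation lemmas (`localInv_ideleInf`,
`localInvInf_ideleInf`) and `ideleData_inf`, generalizing the morphisms before unification (cheap elaboration: never unify two coerced
morphisms that are not syntactically equal). -/

variable (F : Type) [Field F] [NumberField F]

/-- **The family `E ↦ inv_v : H²(Gal(E/F), J_E) → ℚ/ℤ`** (`v` a finite place of `F`) on the layers of `ideleData` (the cell's
`localInv E v`). [cite: CasselsFrohlichANT1967, Ch. VII §9.7 (14)] -/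
def famLocalInv (v : HeightOneSpectrum (𝓞 F)) (E : GalLayer F) :
    groupCohomology ((ideleData F).obj E) 2 →+ AddCircle (1 : ℚ) :=
  haveI := E.numberField; haveI := E.isGalois; IdeleCohomology.localInv E.1 v

/-- `famLocalInv F v E = localInv E v` (for any instances on the layer). [cite: CasselsFrohlichANT1967, Ch. VII §9.7 (14)] -/
theorem famLocalInv_eq (v : HeightOneSpectrum (𝓞 F)) (E : GalLayer F) [NumberField E.1] [IsGalois F E.1] :
    famLocalInv F v E = IdeleCohomology.localInv E.1 v := rfl

/-- **`inv_v ∘ Inf = inv_v` along the system `ideleData`** (`v` finite; the cell's `localInv_ideleInf`, Tate VII §9.7 (14), and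
`ideleData_inf`). [cite: CasselsFrohlichANT1967, Ch. VII §9.7 (14)] -/
theorem famLocalInv_inf (v : HeightOneSpectrum (𝓞 F)) {E E' : GalLayer F} (h : E ≤ E')
    (c : groupCohomology ((ideleData F).obj E) 2) :
    famLocalInv F v E' ((ideleData F).inf h 2 c) = famLocalInv F v E c := by
  haveI := E.numberField
  haveI := E'.numberField
  haveI := E.isGalois
  haveI := E'.isGalois
  letI := GalLayer.algebraOfLE h
  haveI := GalLayer.isScalarTower_of_le h
  rw [famLocalInv_eq F v E', famLocalInv_eq F v E, ideleData_inf h 2]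
  have key := IdeleCohomology.localInv_ideleInf (F := F) (E := E.1) (E' := E'.1) v c
  revert key
  generalize IdeleCohomology.ideleInf F E.1 E'.1 2 = φ
  generalize IdeleCohomology.localInv E'.1 v = L'
  generalize IdeleCohomology.localInv E.1 v = L
  exact id

/-- **The family `E ↦ inv_v : H²(Gal(E/F), J_E) → ℚ/ℤ`** (`v` an infinite place of `F`) on the layers of `ideleData` (the cell's
`localInvInf E v`). [cite: CasselsFrohlichANT1967, Ch. VII §9.7 (14)] -/
def famLocalInvInf (v : InfinitePlace F) (E : GalLayer F) :
    groupCohomology ((ideleData F).obj E) 2 →+ AddCircle (1 : ℚ) :=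
  haveI := E.numberField; haveI := E.isGalois; IdeleCohomology.localInvInf E.1 v

/-- `famLocalInvInf F v E = localInvInf E v`. [cite: CasselsFrohlichANT1967, Ch. VII §9.7 (14)] -/
theorem famLocalInvInf_eq (v : InfinitePlace F) (E : GalLayer F) [NumberField E.1] [IsGalois F E.1] :
    famLocalInvInf F v E = IdeleCohomology.localInvInf E.1 v := rfl

/-- **`inv_v ∘ Inf = inv_v` along the system `ideleData`** (`v` infinite; the cell's `localInvInf_ideleInf`).
[cite: CasselsFrohlichANT1967, Ch. VII §9.7 (14)] -/
theorem famLocalInvInf_inf (v : InfinitePlace F) {E E' : GalLayer F} (h : E ≤ E')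
    (c : groupCohomology ((ideleData F).obj E) 2) :
    famLocalInvInf F v E' ((ideleData F).inf h 2 c) = famLocalInvInf F v E c := by
  haveI := E.numberField
  haveI := E'.numberField
  haveI := E.isGalois
  haveI := E'.isGalois
  letI := GalLayer.algebraOfLE h
  haveI := GalLayer.isScalarTower_of_le h
  rw [famLocalInvInf_eq F v E', famLocalInvInf_eq F v E, ideleData_inf h 2]
  have key := IdeleCohomology.localInvInf_ideleInf (F := F) (E := E.1) (E' := E'.1) v c
  revert key
  generalize IdeleCohomology.ideleInf F E.1 E'.1 2 = φ
  generalize IdeleCohomology.localInvInf E'.1 v = L'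
  generalize IdeleCohomology.localInvInf E.1 v = L
  exact id

/-! ### The descended maps -/

/-- **`inv_v : H²(Γ_F, J̄) →+ ℚ/ℤ` at a finite place `v` of `F`**, descended from the `inv_v` of the layers.
[cite: CasselsFrohlichANT1967, Ch. VII §9.7 (14)][cite: Harari2020, §13.1 Prop. 13.1] -/
def ideleBarLocalInv (v : HeightOneSpectrum (𝓞 F)) :
    Ext (DiscreteRep.triv (Γ := absoluteGaloisGroup F) ℤ) (ideleBarD F) 2 →+ AddCircle (1 : ℚ) :=
  (ideleData F).liftLayer (famLocalInv F v) fun h c => famLocalInv_inf F v h c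

/-- **`inv_v (Inf_E c) = inv_v (c)`** for `c ∈ H²(Gal(E/F), J_E)`, `v` finite. [cite: CasselsFrohlichANT1967, Ch. VII §9.7 (14)] -/
theorem ideleBarLocalInv_inflLayer (v : HeightOneSpectrum (𝓞 F)) (E : GalLayer F)
    (c : groupCohomology ((ideleData F).obj E) 2) :
    ideleBarLocalInv F v ((ideleData F).inflLayer E 2 c) = famLocalInv F v E c := by
  unfold ideleBarLocalInv
  exact (ideleData F).liftLayer_inflLayer (famLocalInv F v) (fun h c => famLocalInv_inf F v h c) E c

/-- `inv_v (Inf_E c) = localInv E v c` (the cell's map, any instances), `v` finite. [cite: CasselsFrohlichANT1967, Ch. VII §9.7 (14)] -/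
theorem ideleBarLocalInv_inflLayer' (v : HeightOneSpectrum (𝓞 F)) (E : GalLayer F) [NumberField E.1] [IsGalois F E.1]
    (c : groupCohomology ((ideleData F).obj E) 2) :
    ideleBarLocalInv F v ((ideleData F).inflLayer E 2 c) = IdeleCohomology.localInv E.1 v c := by
  rw [ideleBarLocalInv_inflLayer, famLocalInv_eq]
  rfl

/-- **`inv_v : H²(Γ_F, J̄) →+ ℚ/ℤ` at an infinite place `v` of `F`**, descended from the `inv_v` of the layers.
[cite: CasselsFrohlichANT1967, Ch. VII §9.7 (14)] -/
def ideleBarLocalInvInf (v : InfinitePlace F) :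
    Ext (DiscreteRep.triv (Γ := absoluteGaloisGroup F) ℤ) (ideleBarD F) 2 →+ AddCircle (1 : ℚ) :=
  (ideleData F).liftLayer (famLocalInvInf F v) fun h c => famLocalInvInf_inf F v h c

/-- `inv_v (Inf_E c) = inv_v (c)`, `v` infinite. [cite: CasselsFrohlichANT1967, Ch. VII §9.7 (14)] -/
theorem ideleBarLocalInvInf_inflLayer (v : InfinitePlace F) (E : GalLayer F)
    (c : groupCohomology ((ideleData F).obj E) 2) :
    ideleBarLocalInvInf F v ((ideleData F).inflLayer E 2 c) = famLocalInvInf F v E c := by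
  unfold ideleBarLocalInvInf
  exact (ideleData F).liftLayer_inflLayer (famLocalInvInf F v) (fun h c => famLocalInvInf_inf F v h c) E c

/-- `inv_v (Inf_E c) = localInvInf E v c`, `v` infinite. [cite: CasselsFrohlichANT1967, Ch. VII §9.7 (14)] -/
theorem ideleBarLocalInvInf_inflLayer' (v : InfinitePlace F) (E : GalLayer F) [NumberField E.1] [IsGalois F E.1]
    (c : groupCohomology ((ideleData F).obj E) 2) :
    ideleBarLocalInvInf F v ((ideleData F).inflLayer E 2 c) = IdeleCohomology.localInvInf E.1 v c := by
  rw [ideleBarLocalInvInf_inflLayer, famLocalInvInf_eq]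
  rfl

/-! ### Almost all vanish; joint injectivity -/

/-- **Almost all local invariants of a class of `H²(Γ_F, J̄)` vanish.** [cite: CasselsFrohlichANT1967, Ch. VII §7.3 Prop. 7.3] -/
theorem exists_finset_forall_ideleBarLocalInv_eq_zero
    (x : Ext (DiscreteRep.triv (Γ := absoluteGaloisGroup F) ℤ) (ideleBarD F) 2) :
    ∃ T : Finset (HeightOneSpectrum (𝓞 F)), ∀ v : HeightOneSpectrum (𝓞 F), v ∉ T → ideleBarLocalInv F v x = 0 := by
  obtain ⟨E, c, rfl⟩ := (ideleData F).exists_inflLayer_eq 2 x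
  haveI := E.numberField
  haveI := E.isGalois
  obtain ⟨T, hT⟩ := IdeleCohomology.exists_finset_forall_localInv_eq_zero (F := F) (E := E.1) c
  refine ⟨T, fun v hv => ?_⟩
  rw [ideleBarLocalInv_inflLayer' F v E c]
  -- the cell's map is generalised before unification (its instance arguments may be presented differently)
  have h := hT v hv
  revert h
  generalize IdeleCohomology.localInv E.1 v = L
  exact id

/-- **`H²(Γ_F, J̄) ↪ ⊕_v ℚ/ℤ`: a class all of whose local invariants (finite and infinite) vanish is zero** (Tate VII §7.3
Cor. 7.4 (b) at every layer: tree `eq_zero_of_forall_localInv_eq_zero'`). [cite: CasselsFrohlichANT1967, Ch. VII §7.3 Cor. 7.4] -/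
theorem ideleBar_eq_zero_of_forall_localInv_eq_zero
    (x : Ext (DiscreteRep.triv (Γ := absoluteGaloisGroup F) ℤ) (ideleBarD F) 2)
    (hfin : ∀ v : HeightOneSpectrum (𝓞 F), ideleBarLocalInv F v x = 0)
    (hinf : ∀ v : InfinitePlace F, ideleBarLocalInvInf F v x = 0) : x = 0 := by
  obtain ⟨E, c, rfl⟩ := (ideleData F).exists_inflLayer_eq 2 x
  haveI := E.numberField
  haveI := E.isGalois
  have hc : c = 0 := by
    refine IdeleCohomology.eq_zero_of_forall_localInv_eq_zero' (F := F) (E := E.1) c (fun v => ?_) (fun v => ?_)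
    · have h := hfin v
      rw [ideleBarLocalInv_inflLayer' F v E c] at h
      revert h
      generalize IdeleCohomology.localInv E.1 v = L
      exact id
    · have h := hinf v
      rw [ideleBarLocalInvInf_inflLayer' F v E c] at h
      revert h
      generalize IdeleCohomology.localInvInf E.1 v = L
      exact id
  rw [hc, map_zero]

/-- **Two classes of `H²(Γ_F, J̄)` with the same local invariants everywhere are equal.**
[cite: CasselsFrohlichANT1967, Ch. VII §7.3 Cor. 7.4] -/
theorem ideleBar_eq_of_forall_localInv_eq (x y : Ext (DiscreteRep.triv (Γ := absoluteGaloisGroup F) ℤ) (ideleBarD F) 2)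
    (hfin : ∀ v : HeightOneSpectrum (𝓞 F), ideleBarLocalInv F v x = ideleBarLocalInv F v y)
    (hinf : ∀ v : InfinitePlace F, ideleBarLocalInvInf F v x = ideleBarLocalInvInf F v y) : x = y := by
  rw [← sub_eq_zero]
  exact ideleBar_eq_zero_of_forall_localInv_eq_zero F (x - y) (fun v => by rw [map_sub, hfin v, sub_self])
    (fun v => by rw [map_sub, hinf v, sub_self])

end Literature.NumberTheory.GaloisRepresentations

end
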